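import Mathlib

/-!
# The transport lemma (seat mine-b, cell pub-perc-repro2)

The abstract form of the absorption program of conjectures/MINE-B.md §32.5 / §33: an exchange defect
`Σ_k P_k c_k + Σ_j Q_j d_j` (outer pairs `k` with weights `P_k` and unsigned coefficients `c_k`, inner
pairs `j` with weights `Q_j` and coefficients `d_j ≤ 0`) is `≤ 0` as soon as a FRACTIONAL TRANSPORT
`λ_{kj} ≥ 0` exists with row sums `P_k`, column sums `≤ Q_j`, and `c_k + d_j ≤ 0` on its support — the
absorption lemmas are the edges, the products of the weights the capacities.  `absorb`, `absorb_two`,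
`absorb_split` (Tail2DFlowTwoLemmas.lean, Tail2DTransportLemmas.lean) are its instances with one, two, and
a pair-plus-couple of absorbers; this is the form recommended for the flow-three assembly (§33.7).
-/

namespace Summit.Ventures.PercRepro2.Tail2D

open Finset

/-- **the transport lemma** -/
theorem transport {ι κ : Type*} [Fintype ι] [Fintype κ] (P c : ι → ℝ) (Q d : κ → ℝ) (lam : ι → κ → ℝ)
    (hd : ∀ j, d j ≤ 0) (hlam : ∀ k j, 0 ≤ lam k j)
    (hrow : ∀ k, ∑ j, lam k j = P k) (hcol : ∀ j, ∑ k, lam k j ≤ Q j)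
    (hedge : ∀ k j, lam k j ≠ 0 → c k + d j ≤ 0) :
    ∑ k, P k * c k + ∑ j, Q j * d j ≤ 0 := by
  have h1 : ∑ k, P k * c k = ∑ k, ∑ j, lam k j * c k := by
    refine Finset.sum_congr rfl (fun k _ => ?_)
    rw [← hrow k, Finset.sum_mul]
  have h2 : ∀ k j, lam k j * c k ≤ lam k j * (-d j) := by
    intro k j
    by_cases h : lam k j = 0
    · simp [h]
    · exact mul_le_mul_of_nonneg_left (by linarith [hedge k j h]) (hlam k j)
  have h3 : ∑ k, ∑ j, lam k j * c k ≤ ∑ k, ∑ j, lam k j * (-d j) :=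
    Finset.sum_le_sum (fun k _ => Finset.sum_le_sum (fun j _ => h2 k j))
  have h4 : ∑ k, ∑ j, lam k j * (-d j) = ∑ j, (∑ k, lam k j) * (-d j) := by
    rw [Finset.sum_comm]
    refine Finset.sum_congr rfl (fun j _ => ?_)
    rw [Finset.sum_mul]
  have h5 : ∀ j, (∑ k, lam k j) * (-d j) ≤ Q j * (-d j) := fun j =>
    mul_le_mul_of_nonneg_right (hcol j) (by linarith [hd j])
  have h6 : ∑ j, (∑ k, lam k j) * (-d j) ≤ ∑ j, Q j * (-d j) := Finset.sum_le_sum (fun j _ => h5 j)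
  have h7 : ∑ j, Q j * (-d j) = -∑ j, Q j * d j := by
    rw [← Finset.sum_neg_distrib]
    refine Finset.sum_congr rfl (fun j _ => ?_)
    ring
  linarith [h1, h3, h4, h6, h7]

/-- the one-absorber instance (`absorb`): `P ≤ Q`, `d ≤ 0`, `c + d ≤ 0` -/
theorem transport_one {P Q c d : ℝ} (hP : 0 ≤ P) (hPQ : P ≤ Q) (hd : d ≤ 0) (hcd : c + d ≤ 0) :
    P * c + Q * d ≤ 0 := by
  have := transport (ι := Fin 1) (κ := Fin 1) (fun _ => P) (fun _ => c) (fun _ => Q) (fun _ => d)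
    (fun _ _ => P) (fun _ => hd) (fun _ _ => hP) (fun _ => by simp) (fun _ => by simpa using hPQ)
    (fun _ _ _ => hcd)
  simpa using this

end Summit.Ventures.PercRepro2.Tail2D
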